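import Literature.NumberTheory.EllipticCurves.CuspFormTwistModularSymbol
import Summits.BirchSwinnertonDyer.BirchSwinnertonDyer.Theorems.ManinLocalTwoThreeManinPrimeToAdditiveFiveLeHorocyclicTransferConverse
import HarnessLib

/-!
# Route `ManinLocalTwoThree`, residual crux C5 `ManinPrimeToAdditiveFiveLe` (stmt-BirchSwinnertonDyer-22969),
# registered stub `stub_ord57` (stmt-27552), line «horocyclic-orientation»: **the horocyclic DICTIONARY for
# Edixhoven's case 1 — BOTTOM(f, χ) ⟺ every horocyclic `k`-th difference of the modular symbol of `f` at every
# cusp `A/C` (`L ∣ C`) lies in `p·Λ_f`** (curve-free, route-independent: a theorem about `S₂(Γ₀(N))`)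

Width seat bsd-line-ml23-c5-p1-w3 (gen 3); sequel of `…HorocyclicBottom` (p636484: BOTTOM ⟹ differences in `pΛ_f`
at cusps with `p ∣ A² − 1`). Two refinements, both used by the line «horocyclic-orientation» (card: «EQUIVALENT on
these rows to ¬BOTTOM (27662) by `stub_notBottom_of_horocyclic57` and its (unfiled) converse»):

* the hypothesis `p ∣ A² − 1` of part 2 is IDLE: `{∞, A/C + n/p}_f` is a period `{∞, γ∞}_f`, `γ ∈ Γ₀(L)`, for EVERY
  `A` prime to `C` (first column `(A + n·C/p, C)`, coprime because `p² ∣ C`) — no conjugate `u_n γ u_n⁻¹` is needed;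
* the converse holds: if all horocyclic differences `Δ^k_{1/p}{∞, A/C}_f` (`L ∣ C ≠ 0`, `gcd(A, C) = 1`) lie in
  `p·Λ_f`, then BOTTOM(`f`, `χ`) — because `Λ(f ⊗ χ)` is generated by the `{∞, γ'∞}_{f⊗χ}`, `γ' ∈ Γ₀(L)`, each of
  which is `g(χ)⁻¹ Σ_u χ(u) {∞, a'/c' + u/p}_f` (`modularSymbol_charTwist`), and `r_χ ∈ ((X−1)^k, p)` in `ℤ[X]`
  (`horocyclic_transfer_abstract_converse`).

Main results (sorry-free; `χ` any quadratic character mod `p` with the Legendre values and `g(χ) ≠ 0` — for the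
quadratic PRIMITIVE character both hold, see `…NotBottomOfHorocyclic`):
* `horocyclic_exists_SL2_cusp_eq` — a matrix `γ ∈ SL(2, ℤ)` with lower-left entry `C` and `γ∞ = A/C + n/p`.
* `horocyclic_modularSymbol_mem_periodLattice` — `{∞, A/C + n/p}_f ∈ Λ_f` (`N ∣ C`, `p² ∣ C`, `gcd(A, C) = 1`).
* `horocyclic_bottom_iff_forall_horocyclicDifference_mem` — **BOTTOM(f, χ) ⟺ ∀ A C, L ∣ C ≠ 0 → gcd(A,C)=1 →
  Σ_{i≤k} (−1)^i C(k,i) {∞, A/C + i/p}_f ∈ p·Λ_f**, `k = (p−1)/2`.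

Consequence for the line (planner-facing, not formalised here beyond the iff): ¬BOTTOM ⟺ SOME cusp `A/C` (`L ∣ C`,
ANY `A` prime to `C`) has `Δ^k ∉ p·Λ_f`; the line's crux H57 additionally demands `A ≡ ±1 (mod p)`, so H57 is
formally STRONGER than K18b″ (27662) unless a normalisation `A ↦ ±1` is supplied.

Nothing about C5, K18b″, Manin's conjecture or BSD is proved in this file.

References: [Shimura1971] Prop. 3.64; [MazurTateTeitelbaum1986Invent] §I.8; [Manin1972] §1.2, Prop. 1.4, Thm. 1.6,
Thm. 1.9; [EdixhovenManin1991] §4 (case 1).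
-/

set_option autoImplicit false
-- the Theorems namespace of this sub repeats the summit name by design (D-0017 nested layout)
set_option linter.dupNamespace false

noncomputable section

open scoped Classical

namespace Summit.BirchSwinnertonDyer.BirchSwinnertonDyer.Theorems

open Finset

section Dictionary

open scoped MatrixGroups ModularForm

open CongruenceSubgroup Literature.NumberTheory.EllipticCurves.ModularForms

/-- `gcd(A + n·C/p, C) = 1` when `gcd(A, C) = 1` and `p² ∣ C` (`C/p` is still divisible by `p`). [folklore] -/
theorem horocyclic_isCoprime_add_mul {p : ℕ} {A C c₁ : ℤ} (hC : C = p * c₁) (hpc : (p : ℤ) ∣ c₁)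
    (hAC : IsCoprime A C) (n : ℤ) : IsCoprime (A + n * c₁) C := by
  obtain ⟨c₂, hc₂⟩ := hpc
  have h1 : IsCoprime (A + n * c₁) c₁ := by
    rw [show A + n * c₁ = A + c₁ * n by ring]
    exact (hAC.of_isCoprime_of_dvd_right ⟨p, by rw [hC]; ring⟩).add_mul_left_left n
  have h2 : IsCoprime (A + n * c₁) (p : ℤ) := by
    rw [hc₂, show A + n * (p * c₂) = A + p * (n * c₂) by ring]
    exact (hAC.of_isCoprime_of_dvd_right ⟨c₁, hC⟩).add_mul_left_left (n * c₂)
  rw [hC]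
  exact h2.mul_right h1

/-- **The cusps `A/C + n/p` are `Γ₀(C)`-translates of `∞`.** For `C ≠ 0`, `p² ∣ C`, `gcd(A, C) = 1` and `n ∈ ℤ` there
is `γ ∈ SL(2, ℤ)` with lower-left entry `C` and `γ∞ = (A + n·C/p)/C = A/C + n/p`. [folklore] -/
theorem horocyclic_exists_SL2_cusp_eq {p : ℕ} (hp : p.Prime) {A C : ℤ} (hC : C ≠ 0) (hpC : (p : ℤ) ^ 2 ∣ C)
    (hAC : IsCoprime A C) (n : ℤ) :
    ∃ γ : SL(2, ℤ), γ 1 0 = C ∧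
      ((γ 0 0 : ℤ) : ℚ) / ((γ 1 0 : ℤ) : ℚ) = (A : ℚ) / (C : ℚ) + (n : ℚ) / (p : ℚ) := by
  obtain ⟨c₂, hc₂⟩ := hpC
  set c₁ : ℤ := p * c₂ with hc₁
  have hC' : C = p * c₁ := by rw [hc₂, hc₁]; ring
  obtain ⟨d, b, hdb⟩ := horocyclic_isCoprime_add_mul hC' ⟨c₂, hc₁⟩ hAC n
  refine ⟨⟨!![A + n * c₁, -b; C, d], by rw [Matrix.det_fin_two_of]; linear_combination hdb⟩, rfl, ?_⟩
  change ((A + n * c₁ : ℤ) : ℚ) / ((C : ℤ) : ℚ) = _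
  have hpQ : (p : ℚ) ≠ 0 := by exact_mod_cast hp.ne_zero
  have hc₂0 : c₂ ≠ 0 := by rintro rfl; exact hC (by rw [hc₂, mul_zero])
  have hcQ : (c₂ : ℚ) ≠ 0 := by exact_mod_cast hc₂0
  rw [hc₂, hc₁]
  push_cast
  field_simp

/-- **`{∞, A/C + n/p}_f ∈ Λ_f`** for `f ∈ S₂(Γ₀(N))`, `N ∣ C ≠ 0`, `p² ∣ C`, `gcd(A, C) = 1`, every `n ∈ ℤ`: it is the
period `{∞, γ∞}_f` of `horocyclic_exists_SL2_cusp_eq` (`γ ∈ Γ₀(N)` since its lower-left entry is `C`).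
[cite: Manin1972, Prop. 1.4  Thm. 1.9] -/
theorem horocyclic_modularSymbol_mem_periodLattice {N : ℕ} (f : CuspForm (Gamma0 N) 2) {p : ℕ} (hp : p.Prime)
    {A C : ℤ} (hNC : (N : ℤ) ∣ C) (hC : C ≠ 0) (hpC : (p : ℤ) ^ 2 ∣ C) (hAC : IsCoprime A C) (n : ℤ) :
    modularSymbol f ((A : ℚ) / (C : ℚ) + (n : ℚ) / (p : ℚ)) ∈ periodLattice f := by
  obtain ⟨γ, hγC, hγ⟩ := horocyclic_exists_SL2_cusp_eq hp hC hpC hAC n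
  have hmem : γ ∈ Gamma0 N := by
    rw [Gamma0_mem, hγC]
    exact (ZMod.intCast_zmod_eq_zero_iff_dvd C N).mpr hNC
  have e : cuspSymbol f ⟨γ, hmem⟩ = modularSymbol f ((A : ℚ) / (C : ℚ) + (n : ℚ) / (p : ℚ)) := by
    show (if (γ 1 0) = 0 then 0 else modularSymbol f (((γ 0 0 : ℤ) : ℚ) / ((γ 1 0 : ℤ) : ℚ))) = _
    rw [if_neg (by rw [hγC]; exact hC), hγ]
  rw [← e]
  exact cuspSymbol_mem_periodLattice f _

/-- **The horocyclic dictionary for Edixhoven's case 1.** Let `f ∈ S₂(Γ₀(N))`, `p` an odd prime, `N ∣ L`, `p² ∣ L`,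
`χ` a quadratic character mod `p` with the Legendre values and `g(χ) ≠ 0`, `k = (p−1)/2`. Then
**BOTTOM(`f`, `χ`)** (`g(χ)·w ∈ p·Λ_f` for every period `w` of `f ⊗ χ ∈ S₂(Γ₀(L))`) **holds iff for all `A, C ∈ ℤ`
with `L ∣ C ≠ 0`, `gcd(A, C) = 1`: `Σ_{i≤k} (−1)^i C(k,i) {∞, A/C + i/p}_f ∈ p·Λ_f`.**
(⟹) `h(n) = {∞, A/C + n/p}_f` is a `p`-periodic `Λ_f`-valued sequence (`horocyclic_modularSymbol_mem_periodLattice`,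
`{∞, r + 1} = {∞, r}`); BOTTOM at `w = {∞, γ_j∞}_{f⊗χ}`, `γ_j∞ = A/C + j/p`, with `modularSymbol_charTwist` gives
`Σ_u χ(u) h(j+u) ∈ pΛ_f`; `horocyclic_transfer_abstract`. (⟸) `Λ(f⊗χ)` is generated by the `{∞, γ'∞}_{f⊗χ}`;
for `γ' = (a' *; c' *)`, `g(χ){∞, a'/c'}_{f⊗χ} = Σ_u χ(u) h'(u)` with `h'(n) = {∞, a'/c' + n/p}_f`, whose horocyclic
differences at all shifts `j` are instances of the hypothesis (cusp `(a' + j c'/p)/c'`);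
`horocyclic_transfer_abstract_converse`. [cite: Shimura1971, Prop. 3.64] [cite: MazurTateTeitelbaum1986Invent, §I.8]
[cite: Manin1972, Prop. 1.4  Thm. 1.9] -/
theorem horocyclic_bottom_iff_forall_horocyclicDifference_mem {N L : ℕ} [NeZero N] [NeZero L]
    (f : CuspForm (Gamma0 N) 2) {p : ℕ} [hp : Fact p.Prime] (hp2 : p ≠ 2) (hN : N ∣ L) (hm : p ^ 2 ∣ L)
    {χ : DirichletCharacter ℂ p} (hχ : χ.IsQuadratic)
    (hχL : ∀ u : ZMod p, χ u = ((quadraticChar (ZMod p) u : ℤ) : ℂ))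
    (hg : gaussSum χ (ZMod.stdAddChar (N := p)) ≠ 0) :
    (∀ w ∈ periodLattice (charTwist L hN hm hχ f), ∃ y ∈ periodLattice f,
        gaussSum χ (ZMod.stdAddChar (N := p)) * w = (p : ℂ) * y) ↔
      ∀ (A C : ℤ), (L : ℤ) ∣ C → C ≠ 0 → IsCoprime A C →
        ∃ y ∈ periodLattice f, (∑ i ∈ Finset.range ((p - 1) / 2 + 1),
          ((((-1 : ℤ) ^ i * (((p - 1) / 2).choose i : ℕ)) : ℤ) : ℂ) *
            modularSymbol f ((A : ℚ) / (C : ℚ) + (i : ℚ) / (p : ℚ))) = (p : ℂ) * y := by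
  have hpQ : (p : ℚ) ≠ 0 := by exact_mod_cast hp.out.ne_zero
  have hpL : ((p : ℤ) ^ 2) ∣ (L : ℤ) := by exact_mod_cast Int.natCast_dvd_natCast.mpr hm
  have hNL : (N : ℤ) ∣ (L : ℤ) := Int.natCast_dvd_natCast.mpr hN
  -- the twisted symbol sum at the cusp `A/C + j/p` is `Σ_u χ_p(u) • {∞, A/C + (j+u)/p}_f`
  have htw : ∀ (A C : ℤ) (j : ℤ),
      gaussSum χ (ZMod.stdAddChar (N := p)) *
          modularSymbol (charTwist L hN hm hχ f) ((A : ℚ) / (C : ℚ) + (j : ℚ) / (p : ℚ)) =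
        ∑ u : ZMod p, (quadraticChar (ZMod p) u : ℤ) •
          modularSymbol f ((A : ℚ) / (C : ℚ) + ((j + (u.val : ℤ) : ℤ) : ℚ) / (p : ℚ)) := by
    intro A C j
    rw [modularSymbol_charTwist, ← mul_assoc, mul_inv_cancel₀ hg, one_mul]
    refine Finset.sum_congr rfl fun u _ ↦ ?_
    rw [zsmul_eq_mul, hχL]
    congr 2
    rw [twistShift]
    push_cast
    ring
  -- a period of the twist at the cusp `A/C + j/p` (`L ∣ C`)
  have hwL : ∀ (A C : ℤ), (L : ℤ) ∣ C → C ≠ 0 → IsCoprime A C → ∀ j : ℤ,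
      modularSymbol (charTwist L hN hm hχ f) ((A : ℚ) / (C : ℚ) + (j : ℚ) / (p : ℚ)) ∈
        periodLattice (charTwist L hN hm hχ f) := fun A C hLC hC hAC j ↦
    horocyclic_modularSymbol_mem_periodLattice _ hp.out hLC hC (hpL.trans hLC) hAC j
  constructor
  · -- (⟹)
    intro hbot A C hLC hC hAC
    set h : ℤ → ℂ := fun n ↦ modularSymbol f ((A : ℚ) / (C : ℚ) + (n : ℚ) / (p : ℚ)) with hh
    have hmem : ∀ n, h n ∈ periodLattice f := fun n ↦
      horocyclic_modularSymbol_mem_periodLattice f hp.out (hNL.trans hLC) hC (hpL.trans hLC) hAC n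
    have hper : ∀ n : ℤ, h (n + p) = h n := by
      intro n
      simp only [hh]
      have e1 : (A : ℚ) / (C : ℚ) + ((n + p : ℤ) : ℚ) / (p : ℚ) =
          (A : ℚ) / (C : ℚ) + (n : ℚ) / (p : ℚ) + ((1 : ℤ) : ℚ) := by
        push_cast
        field_simp
        ring
      rw [e1, modularSymbol_add_intCast_holds f]
    have hbot' : ∀ j : ℤ, ∃ y ∈ periodLattice f,
        ∑ u : ZMod p, (quadraticChar (ZMod p) u : ℤ) • h (j + u.val) = (p : ℤ) • y := by
      intro j
      obtain ⟨y, hy, hyw⟩ := hbot _ (hwL A C hLC hC hAC j)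
      refine ⟨y, hy, ?_⟩
      rw [zsmul_eq_mul, Int.cast_natCast, ← hyw, htw]
    obtain ⟨y, hy, e⟩ := horocyclic_transfer_abstract (periodLattice f) hp2 h hper hmem hbot' 0
    refine ⟨y, hy, ?_⟩
    rw [zsmul_eq_mul, Int.cast_natCast] at e
    rw [← e]
    refine Finset.sum_congr rfl fun i _ ↦ ?_
    rw [zsmul_eq_mul, hh]
    simp only
    congr 2
    push_cast
    ring
  · -- (⟸)
    intro H w hw
    refine AddSubgroup.closure_induction (fun w hw ↦ ?_) ⟨0, (periodLattice f).zero_mem, by simp⟩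
      (fun x y _ _ hx hy ↦ ?_) (fun x _ hx ↦ ?_) hw
    · obtain ⟨γ', rfl⟩ := hw
      by_cases hc' : ((γ' : SL(2, ℤ)) 1 0) = 0
      · refine ⟨0, (periodLattice f).zero_mem, ?_⟩
        simp only [cuspSymbol, if_pos hc', mul_zero]
      · -- the generator `{∞, a'/c'}_{f⊗χ}`
        set a' : ℤ := (γ' : SL(2, ℤ)) 0 0 with ha'
        set b' : ℤ := (γ' : SL(2, ℤ)) 0 1 with hb'
        set c' : ℤ := (γ' : SL(2, ℤ)) 1 0 with hc'def
        set d' : ℤ := (γ' : SL(2, ℤ)) 1 1 with hd'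
        have hdet : a' * d' - b' * c' = 1 := by
          have := Matrix.det_fin_two (γ' : SL(2, ℤ)).1
          rw [(γ' : SL(2, ℤ)).2] at this
          rw [ha', hb', hc'def, hd']
          linarith
        have hcop : IsCoprime a' c' := ⟨d', -b', by linear_combination hdet⟩
        have hLc : (L : ℤ) ∣ c' := by
          have hγ := γ'.2
          rw [Gamma0_mem] at hγ
          exact (ZMod.intCast_zmod_eq_zero_iff_dvd c' L).mp hγ
        obtain ⟨c₂, hc₂⟩ : (p : ℤ) ^ 2 ∣ c' := hpL.trans hLc
        set h' : ℤ → ℂ := fun n ↦ modularSymbol f ((a' : ℚ) / (c' : ℚ) + (n : ℚ) / (p : ℚ)) with hh'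
        have hmem : ∀ n, h' n ∈ periodLattice f := fun n ↦
          horocyclic_modularSymbol_mem_periodLattice f hp.out (hNL.trans hLc) hc' (hpL.trans hLc) hcop n
        have hdiff : ∀ j : ℤ, ∃ y ∈ periodLattice f, ∑ i ∈ Finset.range ((p - 1) / 2 + 1),
            ((-1) ^ i * (((p - 1) / 2).choose i : ℕ) : ℤ) • h' (j + i) = (p : ℤ) • y := by
          intro j
          have hcopj : IsCoprime (a' + j * (p * c₂)) c' :=
            horocyclic_isCoprime_add_mul (c₁ := p * c₂) (by rw [hc₂]; ring) ⟨c₂, rfl⟩ hcop j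
          obtain ⟨y, hy, e⟩ := H (a' + j * (p * c₂)) c' hLc hc' hcopj
          refine ⟨y, hy, ?_⟩
          rw [zsmul_eq_mul, Int.cast_natCast, ← e]
          refine Finset.sum_congr rfl fun i _ ↦ ?_
          rw [zsmul_eq_mul, hh']
          simp only
          congr 2
          have hc₂0 : c₂ ≠ 0 := by rintro rfl; exact hc' (by rw [hc₂, mul_zero])
          have hcQ : (c₂ : ℚ) ≠ 0 := by exact_mod_cast hc₂0
          rw [hc₂]
          push_cast
          field_simp
          ring
        obtain ⟨y, hy, e⟩ := horocyclic_transfer_abstract_converse (periodLattice f) hp2 h' hmem hdiff 0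
        refine ⟨y, hy, ?_⟩
        rw [zsmul_eq_mul, Int.cast_natCast] at e
        have hc'' : ((γ' : SL(2, ℤ)) 1 0) ≠ 0 := by rw [← hc'def]; exact hc'
        have hw' : cuspSymbol (charTwist L hN hm hχ f) γ' =
            modularSymbol (charTwist L hN hm hχ f) ((a' : ℚ) / (c' : ℚ) + ((0 : ℤ) : ℚ) / (p : ℚ)) := by
          rw [Int.cast_zero, zero_div, add_zero, ha', hc'def]
          simp only [cuspSymbol, if_neg hc'']
        rw [hw', htw, ← e]
    · obtain ⟨y₁, hy₁, e₁⟩ := hx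
      obtain ⟨y₂, hy₂, e₂⟩ := hy
      exact ⟨y₁ + y₂, (periodLattice f).add_mem hy₁ hy₂, by rw [mul_add, e₁, e₂, mul_add]⟩
    · obtain ⟨y₁, hy₁, e₁⟩ := hx
      exact ⟨-y₁, (periodLattice f).neg_mem hy₁, by rw [mul_neg, e₁, mul_neg]⟩

end Dictionary

end Summit.BirchSwinnertonDyer.BirchSwinnertonDyer.Theorems

end
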